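/-
Copyright (c) 2026 the pub-hodgecm-mathlib formalisation cell (harness21).  Prover seat hodgecm-mathlib-K2E4-p11 (g4), Track B ∕ K2-LIT, h413 =
`stmt-HodgeConjecture-24833`, line `K2_E1_TraceFormulaBeta`, campaign «EIS-RANK-ONE», rung R6d₃, deal «(R3u)₃» of K2E1-plan (g4) 2026-09-04T07:03:26Z (RULING «CONSTANTS-FIRST»
07:06:19Z), FILE U3b — THE HEAD: the z-UNIFORM cusp bound for the flat sections `f_z`, `z ∈ Kc` compact `⊂ {2 < Re z}`, of `U(2,1)` over a CM field, from the archimedean binders.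
-/
import Summits.HodgeConjecture.HodgeConjecture.Theorems.K2E1EisensteinMinusConstantTermDecayInputsFamilyU3   -- U2 (K2-defs1 (g4)): ★ p858073 constants-first (`hdecE`, `hdecF`); brings ★ A p858097's inputs
import Summits.HodgeConjecture.HodgeConjecture.Theorems.K2E1EisensteinMinusConstantTermBoundedCMThreeArch     -- ★ B p858125 (K2-defs1 (g4)) + ★ A p858097 and everything below them
import Summits.HodgeConjecture.HodgeConjecture.Theorems.K2E1FlatSectionLineRestrictionArchFamilyU3          -- ★ U1 p858166 (this seat): PART II constants-first
import Summits.HodgeConjecture.HodgeConjecture.Theorems.K2E1CentreLineMassUniformCMThree                    -- U3a (this seat): ONE `N`, `B_F`, `θ` on `Kc`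
import Summits.HodgeConjecture.HodgeConjecture.Theorems.K2E1CentreAverageMassU3                           -- ★ (D2-g) p858187 (K2-defs1 (g4)): the E-layer masses
import Summits.HodgeConjecture.HodgeConjecture.Theorems.K2E1TruncatedEisensteinLocallyUniformCMThree        -- ★ (R6g-a)₃: the 1-call plug `…_le_uniform_cm_three`
import HarnessLib

/-!
# h413 ∕ Track B «K2-LIT», «EIS-RANK-ONE» (R3u)₃ FILE U3b — `K2E1EisensteinMinusConstantTermBoundedCMThreeUniform`:
# `∃ M₁, ∀ z ∈ Kc, ∀ g, T < H(g) → ‖E(f_z)(g) − E(f_z)_B(g)‖ ≤ M₁` on `U(2,1)` over a CM field, UNIFORMLY on compact `Kc ⊂ {2 < Re z}`, from `hφarch` ∕ `hφarchZ`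

Cell `pub/hodgecm-mathlib`, crux H413 = `stmt-HodgeConjecture-24833`, route `HCCMUnconditional`; dealer K2E1-plan (g4), deal «(R3u)₃» 2026-09-04T07:03:26Z, REPORT-FIRST 07:05:55Z, RULING
«CONSTANTS-FIRST» 07:06:19Z (cut U1 ∕ U2 ∕ U3).  THEOREMS ONLY (no `def`, no `instance`, no `notation`, no named-fact hypothesis, no `sorry`); lane
`--kind proof --supports stmt-HodgeConjecture-24833 --as helper` (count-neutral).  N = 2 twin: ★ p858054 `K2E1EisensteinMinusConstantTermBoundedLevelCMTwoUniform` (K2E1-p09 (g5)).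
THE ASSEMBLY.  ★ edition A (p858097) re-run in FAMILY form: every constant is produced BEFORE `z ∈ Kc` — the PART II constants `C′_F`, `C′_E` (★ U1 p858166), the envelope mass `N`, the shell
constant `B_F` and exponent `θ = 1 + σ₁` (U3a `exists_uniform_centreLine_mass_and_shell_cm_three`), the E-layer mass `NE` (§1, from ★ (D2-g) with the two-exponent envelope), hence the decay
constants `C_E` and `B` of ★ U2 (`hdecE` ∕ `hdecF` constants-first) — and `M₁ := μ_F(D_F)⁻¹·B + μ_E(D_E)⁻¹·C_E`; then for each `z ∈ Kc` the 24 binders of ★ R6d₃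
`forall_norm_sub_borelConstantTerm_le_three` are discharged exactly as in ★ A (Godement ★ at `Re z > 2`, ★ FILE A∕B, ★ (ν-1)(ν-2), ★ [D8]) with the archimedean triples from ★ U1 at
`f := f_z`, `𝓔 := C_φ·H^{Re z}`.
* §1 **`exists_uniform_centreAverage_mass_cm_three`** — ONE `NE` with `Integrable (X ↦ ∫ C_φ·H(…k)^{Re z} dμ_F) μ_E ∧ ∫∫ ≤ NE` for all `z ∈ Kc`, `k ∈ K_U` (★ (D2-g) at `Re z`, `σ₁`, `σ₂`).
* §2 THE HEAD **`exists_bound_sub_borelConstantTerm_level_cm_three_uniform_of_archSmooth`** — binders: the CM∕Haar∕level letters of ★ B, `hf` for every `z ∈ Kc`, and `hφarch` ∕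
  `hφarchZ` for every `z ∈ Kc` with ONE `C_φ` (envelope `C_φ·H^{Re z}`, PART II bytes; payer K2E1-p08 (g5) (a3)₃, Kc-uniform edition (q11)); NOTHING ELSE.
* §3 **`exists_norm_truncation_flatSectionU_le_level_cm_three_uniform_of_archSmooth`** — `∃ M, ∀ z ∈ Kc, ∀ g, ‖Λ^T E(f_z)(g)‖ ≤ M`, the 1-call composition with ★ (R6g-a)₃
  `exists_norm_truncation_eisensteinSeriesU_flatSectionU_le_uniform_cm_three` — the `hdec′`∕`hdecU` survivor of the N = 3 Maass–Selberg capstone.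
HONEST LABEL.  Count-neutral helper; proves no printed statement; HC_CM is proved only modulo the 7 printed citations (2 remaining named inputs: hLiu418 =
`stmt-HodgeConjecture-24832`, h413 = `stmt-HodgeConjecture-24833`) until rung 0 closes.  `hφarch` ∕ `hφarchZ` (uniform on `Kc`) are NOT discharged here.

## References
* [MoeglinWaldspurger1995] C. Mœglin, J.-L. Waldspurger, *Spectral decomposition and Eisenstein series* (1995), I.2.10–I.2.13, II.1.7, IV.2.
* [Garrett2018] P. Garrett, *Modern Analysis of Automorphic Forms by Example* 1 (2018), §2.8–§2.11, §12.2.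
* [Arthur1980TraceFormulaII] J. Arthur, *A trace formula for reductive groups II*, Compositio Math. 40 (1980), §4.
-/

set_option autoImplicit false
set_option linter.dupNamespace false  -- the mandated namespace repeats the summit's segment (`HodgeConjecture.HodgeConjecture`)

noncomputable section

open MeasureTheory Measure Filter Topology NumberField IsDedekindDomain MulAction Module
open Literature.NumberTheory.Automorphic Literature.NumberTheory.Automorphic.UnitaryGroup Literature.NumberTheory.GaloisRepresentations
open Summit.HodgeConjecture.HodgeConjecture.Cruxes.H413.K2E1BorelEisensteinU
open Summit.HodgeConjecture.HodgeConjecture.Cruxes.H413.K2E1EisensteinMinusConstantTermCuspBoundU3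
open Summit.HodgeConjecture.HodgeConjecture.Cruxes.H413.K2E1EisensteinMinusConstantTermPoissonInputsU3
open Summit.HodgeConjecture.HodgeConjecture.Cruxes.H413.K2E1EisensteinMinusConstantTermDecayInputsFamilyU3
open Summit.HodgeConjecture.HodgeConjecture.Cruxes.H413.K2E1FlatSectionLineRestrictionU3
open Summit.HodgeConjecture.HodgeConjecture.Cruxes.H413.K2E1FlatSectionCentreAverageU3
open Summit.HodgeConjecture.HodgeConjecture.Cruxes.H413.K2E1FlatSectionLineRestrictionArchFamilyU3
open Summit.HodgeConjecture.HodgeConjecture.Cruxes.H413.K2E1UnipotentHaarNormalisationU3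
open Summit.HodgeConjecture.HodgeConjecture.Cruxes.H413.K2E1HeisenbergHaarU3
open Summit.HodgeConjecture.HodgeConjecture.Cruxes.H413.K2E1IntertwiningGrowthU3
open Summit.HodgeConjecture.HodgeConjecture.Cruxes.H413.K2E1BorelEisensteinGodementCMThree
open Summit.HodgeConjecture.HodgeConjecture.Cruxes.H413.K2E1EisensteinAnalyticBinders
open Summit.HodgeConjecture.HodgeConjecture.Cruxes.H413.K2E1EisensteinMinusConstantTermBoundedCMTwo
open Summit.HodgeConjecture.HodgeConjecture.Cruxes.H413.K2E1CentreLineMassU3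
open Summit.HodgeConjecture.HodgeConjecture.Cruxes.H413.K2E1CentreLineMassUniformCMThree
open Summit.HodgeConjecture.HodgeConjecture.Cruxes.H413.K2E1CentreAverageMassU3
open Summit.HodgeConjecture.HodgeConjecture.Cruxes.H413.K2E1TruncatedEisensteinLocallyUniformCMThree
open NumberField.mixedEmbedding
-- `Classical` is needed to see the Mathlib normed-space instances on `mixedSpace` (note H5 of `AdelicGLnGlue`)
open scoped ENNReal NNReal Classical

namespace Summit.HodgeConjecture.HodgeConjecture.Cruxes.H413.K2E1EisensteinMinusConstantTermBoundedCMThreeUniform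

variable (L : Type) [Field L] [NumberField L] [IsCMField L]
  [MeasurableSpace (quasiSplit (↥(maximalRealSubfield L)) L (IsCMField.complexConj L) 3).Adelic] [BorelSpace (quasiSplit (↥(maximalRealSubfield L)) L (IsCMField.complexConj L) 3).Adelic]
  [MeasurableSpace (AdeleRing (𝓞 L) L)] [BorelSpace (AdeleRing (𝓞 L) L)]
  [MeasurableSpace (InfiniteAdeleRing L)] [BorelSpace (InfiniteAdeleRing L)]
  [MeasurableSpace (FiniteAdeleRing (𝓞 L) L)] [BorelSpace (FiniteAdeleRing (𝓞 L) L)]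
  [MeasurableSpace (AdeleRing (𝓞 ↥(maximalRealSubfield L)) ↥(maximalRealSubfield L))] [BorelSpace (AdeleRing (𝓞 ↥(maximalRealSubfield L)) ↥(maximalRealSubfield L))]
  [MeasurableSpace (InfiniteAdeleRing ↥(maximalRealSubfield L))] [BorelSpace (InfiniteAdeleRing ↥(maximalRealSubfield L))]
  [MeasurableSpace (FiniteAdeleRing (𝓞 ↥(maximalRealSubfield L)) ↥(maximalRealSubfield L))] [BorelSpace (FiniteAdeleRing (𝓞 ↥(maximalRealSubfield L)) ↥(maximalRealSubfield L))]

/-! ## §1 ONE E-layer mass `NE` on `Kc` -/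

omit [MeasurableSpace (InfiniteAdeleRing L)] [BorelSpace (InfiniteAdeleRing L)] [MeasurableSpace (FiniteAdeleRing (𝓞 L) L)] [BorelSpace (FiniteAdeleRing (𝓞 L) L)]
  [MeasurableSpace (InfiniteAdeleRing ↥(maximalRealSubfield L))] [BorelSpace (InfiniteAdeleRing ↥(maximalRealSubfield L))]
  [MeasurableSpace (FiniteAdeleRing (𝓞 ↥(maximalRealSubfield L)) ↥(maximalRealSubfield L))] [BorelSpace (FiniteAdeleRing (𝓞 ↥(maximalRealSubfield L)) ↥(maximalRealSubfield L))] in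
/-- **ONE E-LAYER MASS FOR THE FAMILY `C_φ·H^{Re z}`, `z ∈ Kc`** (compact `Kc ⊂ {2 < Re z}`): `∃ NE, ∀ z ∈ Kc, ∀ k ∈ K_U, Integrable (X ↦ ∫ C_φ·H(ι(w₀)u(X,θt)k)^{Re z} dμ_F) μ_E ∧
∫∫ ≤ NE` — ★ (D2-g) `integrable_centreAverageMass_const_mul_cm_three` at `Re z`, `σ₁`, `σ₂` and `exists_forall_integral_integral_centreLine_const_mul_borelHeight_rpow_le` at `σ₁`, `σ₂`
(`H^{Re z} ≤ H^{σ₁} + H^{σ₂}` ★, the centre lines integrable ★ p858088). [cite: MoeglinWaldspurger1995, II.1.6–II.1.7, IV.2] -/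
theorem exists_uniform_centreAverage_mass_cm_three {δ : L} (hc : IsCMField.complexConj L * IsCMField.complexConj L = 1) (hcδ : IsCMField.complexConj L δ = -δ) (hδ : δ ≠ 0)
    (ν : Measure ↥(adelicUnipotent ↥(maximalRealSubfield L) L (IsCMField.complexConj L) 3)) [ν.IsHaarMeasure]
    {𝓕 : Set ↥(adelicUnipotent ↥(maximalRealSubfield L) L (IsCMField.complexConj L) 3)} (h𝓕 : IsFundamentalDomain ↥(rationalUnipotent ↥(maximalRealSubfield L) L (IsCMField.complexConj L) 3) 𝓕 ν) (h𝓕c : IsCompact (closure 𝓕))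
    (μF : Measure (AdeleRing (𝓞 ↥(maximalRealSubfield L)) ↥(maximalRealSubfield L))) [μF.IsAddHaarMeasure] (μE : Measure (AdeleRing (𝓞 L) L)) [μE.IsAddHaarMeasure]
    {Kc : Set ℂ} (hKc : IsCompact Kc) (hKc2 : ∀ z ∈ Kc, 2 < z.re) {Cφ : ℝ} (hCφ : 0 ≤ Cφ) :
    ∃ NE : ℝ, ∀ z ∈ Kc, ∀ k ∈ ((standardMaximalCompactGL 3 L).comap (adelicVal ↥(maximalRealSubfield L) L (IsCMField.complexConj L) 3 ((StdForm.antidiagonal 3).over L)) :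
        Subgroup (quasiSplit (↥(maximalRealSubfield L)) L (IsCMField.complexConj L) 3).Adelic),
      Integrable (fun X : AdeleRing (𝓞 L) L => ∫ t, (fun y : (quasiSplit (↥(maximalRealSubfield L)) L (IsCMField.complexConj L) 3).Adelic => Cφ * ((borelHeight y : ℝ)) ^ z.re)
        (((quasiSplit (↥(maximalRealSubfield L)) L (IsCMField.complexConj L) 3).toAdelic (weylLongU ((IsCMField.complexConj L : L ≃ₐ[↥(maximalRealSubfield L)] L) : L →+* L) (rfl : ((StdForm.antidiagonal 3).over L) = ((StdForm.antidiagonal 3).over L)))) *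
          ((heisChart hc (X, traceZeroLine ↥(maximalRealSubfield L) L (IsCMField.complexConj L) hcδ hδ t) : ↥(adelicUnipotent ↥(maximalRealSubfield L) L (IsCMField.complexConj L) 3)) :
            (quasiSplit (↥(maximalRealSubfield L)) L (IsCMField.complexConj L) 3).Adelic) * k) ∂μF) μE ∧
      ∫ X, ∫ t, (fun y : (quasiSplit (↥(maximalRealSubfield L)) L (IsCMField.complexConj L) 3).Adelic => Cφ * ((borelHeight y : ℝ)) ^ z.re)
        (((quasiSplit (↥(maximalRealSubfield L)) L (IsCMField.complexConj L) 3).toAdelic (weylLongU ((IsCMField.complexConj L : L ≃ₐ[↥(maximalRealSubfield L)] L) : L →+* L) (rfl : ((StdForm.antidiagonal 3).over L) = ((StdForm.antidiagonal 3).over L)))) *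
          ((heisChart hc (X, traceZeroLine ↥(maximalRealSubfield L) L (IsCMField.complexConj L) hcδ hδ t) : ↥(adelicUnipotent ↥(maximalRealSubfield L) L (IsCMField.complexConj L) 3)) :
            (quasiSplit (↥(maximalRealSubfield L)) L (IsCMField.complexConj L) 3).Adelic) * k) ∂μF ∂μE ≤ NE := by
  haveI : Algebra.IsQuadraticExtension ↥(maximalRealSubfield L) L := IsCMField.isQuadraticExtension L
  have hc1 : IsCMField.complexConj L ≠ 1 := IsCMField.complexConj_ne_one L
  have hIw := exists_mem_borelAdelic_mul_mem_standardMaximalCompactGL_cm_three L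
  rcases Kc.eq_empty_or_nonempty with hKe | hKne
  · exact ⟨0, fun z hz => by simp [hKe] at hz⟩
  obtain ⟨z₁, hz₁, hmin⟩ := hKc.exists_isMinOn hKne Complex.continuous_re.continuousOn
  obtain ⟨z₂, hz₂, hmax⟩ := hKc.exists_isMaxOn hKne Complex.continuous_re.continuousOn
  have hσ₁ : 2 < z₁.re := hKc2 z₁ hz₁
  have hσ₂ : 2 < z₂.re := hKc2 z₂ hz₂
  obtain ⟨NE₁, hNE₁⟩ := exists_forall_integral_integral_centreLine_const_mul_borelHeight_rpow_le hc hcδ hδ μF μE Cφ z₁.re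
  obtain ⟨NE₂, hNE₂⟩ := exists_forall_integral_integral_centreLine_const_mul_borelHeight_rpow_le hc hcδ hδ μF μE Cφ z₂.re
  refine ⟨NE₁ + NE₂, fun z hz k hk => ?_⟩
  have h1 : z₁.re ≤ z.re := hmin hz
  have h2 : z.re ≤ z₂.re := hmax hz
  have hz2 : 2 < z.re := hKc2 z hz
  set W : (quasiSplit (↥(maximalRealSubfield L)) L (IsCMField.complexConj L) 3).Adelic := ((quasiSplit (↥(maximalRealSubfield L)) L (IsCMField.complexConj L) 3).toAdelic
    (weylLongU ((IsCMField.complexConj L : L ≃ₐ[↥(maximalRealSubfield L)] L) : L →+* L) (rfl : ((StdForm.antidiagonal 3).over L) = ((StdForm.antidiagonal 3).over L)))) with hW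
  have hIz := integrable_centreAverageMass_const_mul_cm_three L hc hcδ hδ ν h𝓕 h𝓕c μF μE Cφ hz2 k hk
  have hI₁ := integrable_centreAverageMass_const_mul_cm_three L hc hcδ hδ ν h𝓕 h𝓕c μF μE Cφ hσ₁ k hk
  have hI₂ := integrable_centreAverageMass_const_mul_cm_three L hc hcδ hδ ν h𝓕 h𝓕c μF μE Cφ hσ₂ k hk
  refine ⟨hIz, ?_⟩
  -- pointwise in `X`: the inner integrals compare (all three centre lines are integrable ★ p858088)
  have hinner : ∀ X : AdeleRing (𝓞 L) L,
      ∫ t, (fun y : (quasiSplit (↥(maximalRealSubfield L)) L (IsCMField.complexConj L) 3).Adelic => Cφ * ((borelHeight y : ℝ)) ^ z.re)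
        (W * ((heisChart hc (X, traceZeroLine ↥(maximalRealSubfield L) L (IsCMField.complexConj L) hcδ hδ t) : ↥(adelicUnipotent ↥(maximalRealSubfield L) L (IsCMField.complexConj L) 3)) :
          (quasiSplit (↥(maximalRealSubfield L)) L (IsCMField.complexConj L) 3).Adelic) * k) ∂μF ≤
      ∫ t, (fun y : (quasiSplit (↥(maximalRealSubfield L)) L (IsCMField.complexConj L) 3).Adelic => Cφ * ((borelHeight y : ℝ)) ^ z₁.re)
        (W * ((heisChart hc (X, traceZeroLine ↥(maximalRealSubfield L) L (IsCMField.complexConj L) hcδ hδ t) : ↥(adelicUnipotent ↥(maximalRealSubfield L) L (IsCMField.complexConj L) 3)) :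
          (quasiSplit (↥(maximalRealSubfield L)) L (IsCMField.complexConj L) 3).Adelic) * k) ∂μF +
      ∫ t, (fun y : (quasiSplit (↥(maximalRealSubfield L)) L (IsCMField.complexConj L) 3).Adelic => Cφ * ((borelHeight y : ℝ)) ^ z₂.re)
        (W * ((heisChart hc (X, traceZeroLine ↥(maximalRealSubfield L) L (IsCMField.complexConj L) hcδ hδ t) : ↥(adelicUnipotent ↥(maximalRealSubfield L) L (IsCMField.complexConj L) 3)) :
          (quasiSplit (↥(maximalRealSubfield L)) L (IsCMField.complexConj L) 3).Adelic) * k) ∂μF := by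
    intro X
    have hiz := (integrable_centreLine_borelHeight_rpow_three hc hc1 hcδ hδ hIw μF hz2 X k).const_mul Cφ
    have hi₁ := (integrable_centreLine_borelHeight_rpow_three hc hc1 hcδ hδ hIw μF hσ₁ X k).const_mul Cφ
    have hi₂ := (integrable_centreLine_borelHeight_rpow_three hc hc1 hcδ hδ hIw μF hσ₂ X k).const_mul Cφ
    rw [← integral_add hi₁ hi₂]
    refine integral_mono hiz (hi₁.add hi₂) fun t => ?_
    dsimp only
    rw [← mul_add]
    exact mul_le_mul_of_nonneg_left (K2E1BorelEisensteinRegularCMThree.rpow_le_rpow_add_rpow (by exact_mod_cast borelHeight_pos _) h1 h2) hCφ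
  calc _ ≤ ∫ X, (∫ t, (fun y : (quasiSplit (↥(maximalRealSubfield L)) L (IsCMField.complexConj L) 3).Adelic => Cφ * ((borelHeight y : ℝ)) ^ z₁.re)
          (W * ((heisChart hc (X, traceZeroLine ↥(maximalRealSubfield L) L (IsCMField.complexConj L) hcδ hδ t) : ↥(adelicUnipotent ↥(maximalRealSubfield L) L (IsCMField.complexConj L) 3)) :
            (quasiSplit (↥(maximalRealSubfield L)) L (IsCMField.complexConj L) 3).Adelic) * k) ∂μF +
        ∫ t, (fun y : (quasiSplit (↥(maximalRealSubfield L)) L (IsCMField.complexConj L) 3).Adelic => Cφ * ((borelHeight y : ℝ)) ^ z₂.re)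
          (W * ((heisChart hc (X, traceZeroLine ↥(maximalRealSubfield L) L (IsCMField.complexConj L) hcδ hδ t) : ↥(adelicUnipotent ↥(maximalRealSubfield L) L (IsCMField.complexConj L) 3)) :
            (quasiSplit (↥(maximalRealSubfield L)) L (IsCMField.complexConj L) 3).Adelic) * k) ∂μF) ∂μE := integral_mono hIz (hI₁.add hI₂) hinner
    _ = _ := integral_add hI₁ hI₂
    _ ≤ NE₁ + NE₂ := add_le_add (hNE₁ k hk) (hNE₂ k hk)

/-! ## §2 The head: the z-uniform cusp bound -/

/-- **(R3u)₃ — `E(f_z) − E(f_z)_B` IS BOUNDED IN THE CUSP OF `U(2,1)` OVER A CM FIELD, UNIFORMLY FOR `z` IN A COMPACT `Kc ⊂ {2 < Re z}`**, from the archimedean smoothness binders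
`hφarch` ∕ `hφarchZ` (every `z ∈ Kc`, ONE `C_φ`, envelope `C_φ·H^{Re z}`): `∃ M₁, ∀ z ∈ Kc, ∀ g, T < H(g) → ‖E(f_z)(g) − E(f_z)_B(g)‖ ≤ M₁` — ★ edition A in family form over the
constants-first inputs ★ U1 ∕ ★ U2 ∕ U3a ∕ §1 (module docstring).  This is the `hdec` input of ★ (R6g-a)₃ `exists_norm_truncation_eisensteinSeriesU_flatSectionU_le_uniform_cm_three`.
[cite: MoeglinWaldspurger1995, I.2.10–I.2.12, II.1.7, IV.2] [cite: Garrett2018, §2.9, §12.2] [cite: Arthur1980TraceFormulaII, §4] -/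
theorem exists_bound_sub_borelConstantTerm_level_cm_three_uniform_of_archSmooth {δ : L} (hc : IsCMField.complexConj L * IsCMField.complexConj L = 1) (hcδ : IsCMField.complexConj L δ = -δ) (hδ : δ ≠ 0)
    (ν : Measure ↥(adelicUnipotent ↥(maximalRealSubfield L) L (IsCMField.complexConj L) 3)) [ν.IsHaarMeasure]
    {𝓕 : Set ↥(adelicUnipotent ↥(maximalRealSubfield L) L (IsCMField.complexConj L) 3)} (h𝓕 : IsFundamentalDomain ↥(rationalUnipotent ↥(maximalRealSubfield L) L (IsCMField.complexConj L) 3) 𝓕 ν) (h𝓕c : IsCompact (closure 𝓕))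
    (μF : Measure (AdeleRing (𝓞 ↥(maximalRealSubfield L)) ↥(maximalRealSubfield L))) [μF.IsAddHaarMeasure] (μF₁ : Measure (InfiniteAdeleRing ↥(maximalRealSubfield L))) [μF₁.IsAddHaarMeasure]
    (μF₂ : Measure (FiniteAdeleRing (𝓞 ↥(maximalRealSubfield L)) ↥(maximalRealSubfield L))) [μF₂.IsAddHaarMeasure]
    (μE : Measure (AdeleRing (𝓞 L) L)) [μE.IsAddHaarMeasure] (μE₁ : Measure (InfiniteAdeleRing L)) [μE₁.IsAddHaarMeasure]
    (μE₂ : Measure (FiniteAdeleRing (𝓞 L) L)) [μE₂.IsAddHaarMeasure]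
    (χ : HeckeCharacter L) (hχ : χ.IsUnitary) {Kc : Set ℂ} (hKc : IsCompact Kc) (hKc2 : ∀ z ∈ Kc, 2 < z.re)
    {φ : (quasiSplit (↥(maximalRealSubfield L)) L (IsCMField.complexConj L) 3).Adelic → ℂ} (hφc : Continuous φ) {Mφ : ℝ} (hφM : ∀ x, ‖φ x‖ ≤ Mφ)
    (hφB : ∀ b ∈ borelU ((IsCMField.complexConj L : L ≃ₐ[↥(maximalRealSubfield L)] L) : L →+* L) ((StdForm.antidiagonal 3).over L), ∀ x : (quasiSplit (↥(maximalRealSubfield L)) L (IsCMField.complexConj L) 3).Adelic, φ ((quasiSplit (↥(maximalRealSubfield L)) L (IsCMField.complexConj L) 3).toAdelic b * x) = φ x)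
    (hf : ∀ z ∈ Kc, ∀ (b g : (quasiSplit (↥(maximalRealSubfield L)) L (IsCMField.complexConj L) 3).Adelic) (hb : b ∈ borelAdelic ↥(maximalRealSubfield L) L (IsCMField.complexConj L) 3),
      flatSectionU φ z (b * g) = ((χ (diagUnit hb 0) : ℂˣ) : ℂ) * ((ideleNorm (diagUnit hb 0) : ℝ) : ℂ) ^ z * flatSectionU φ z g)
    {U₀ : Subgroup (GL (Fin 3) (FiniteAdeleRing (𝓞 L) L))} (hU₀o : IsOpen (U₀ : Set (GL (Fin 3) (FiniteAdeleRing (𝓞 L) L)))) (hU₀K : U₀ ≤ glFiniteIntegralLevel 3 L)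
    (hφU : ∀ u : (quasiSplit (↥(maximalRealSubfield L)) L (IsCMField.complexConj L) 3).Adelic, adelicVal ↥(maximalRealSubfield L) L (IsCMField.complexConj L) 3 ((StdForm.antidiagonal 3).over L) u ∈ U₀.map (GLn.ofFinite 3 L) → ∀ y : (quasiSplit (↥(maximalRealSubfield L)) L (IsCMField.complexConj L) 3).Adelic, φ (y * u) = φ y)
    {T : ℝ≥0} (hT : 1 ≤ T) {m : ℕ} (hm : (finrank ℚ L : ℝ) < m) {Cφ : ℝ} (hCφ : 0 ≤ Cφ)
    -- the archimedean smoothness binders of ★ PART II for EVERY `z ∈ Kc`, ONE constant `C_φ`, envelope `C_φ·H^{Re z}` (payer: K2E1-p08 (g5) (a3)₃ ∕ (q11))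
    (hφarch : ∀ z ∈ Kc, ∀ k ∈ ((standardMaximalCompactGL 3 L).comap (adelicVal ↥(maximalRealSubfield L) L (IsCMField.complexConj L) 3 ((StdForm.antidiagonal 3).over L)) : Subgroup (quasiSplit (↥(maximalRealSubfield L)) L (IsCMField.complexConj L) 3).Adelic), ∀ (X : AdeleRing (𝓞 L) L) (b : FiniteAdeleRing (𝓞 ↥(maximalRealSubfield L)) ↥(maximalRealSubfield L)),
      ContDiff ℝ m ((fun a : InfiniteAdeleRing ↥(maximalRealSubfield L) => flatSectionU φ z (((quasiSplit (↥(maximalRealSubfield L)) L (IsCMField.complexConj L) 3).toAdelic (weylLongU ((IsCMField.complexConj L : L ≃ₐ[↥(maximalRealSubfield L)] L) : L →+* L) (rfl : ((StdForm.antidiagonal 3).over L) = ((StdForm.antidiagonal 3).over L)))) *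
          ((heisChart hc (X, traceZeroLine ↥(maximalRealSubfield L) L (IsCMField.complexConj L) hcδ hδ ((a, b) : AdeleRing (𝓞 ↥(maximalRealSubfield L)) ↥(maximalRealSubfield L))) : ↥(adelicUnipotent ↥(maximalRealSubfield L) L (IsCMField.complexConj L) 3)) : (quasiSplit (↥(maximalRealSubfield L)) L (IsCMField.complexConj L) 3).Adelic) * k)) ∘
        (InfiniteAdeleRing.ringEquiv_mixedSpace ↥(maximalRealSubfield L)).symm) ∧
      ∀ j : ℕ, j ≤ m → ∀ s : mixedSpace ↥(maximalRealSubfield L),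
        ‖iteratedFDeriv ℝ j ((fun a : InfiniteAdeleRing ↥(maximalRealSubfield L) => flatSectionU φ z (((quasiSplit (↥(maximalRealSubfield L)) L (IsCMField.complexConj L) 3).toAdelic (weylLongU ((IsCMField.complexConj L : L ≃ₐ[↥(maximalRealSubfield L)] L) : L →+* L) (rfl : ((StdForm.antidiagonal 3).over L) = ((StdForm.antidiagonal 3).over L)))) *
          ((heisChart hc (X, traceZeroLine ↥(maximalRealSubfield L) L (IsCMField.complexConj L) hcδ hδ ((a, b) : AdeleRing (𝓞 ↥(maximalRealSubfield L)) ↥(maximalRealSubfield L))) : ↥(adelicUnipotent ↥(maximalRealSubfield L) L (IsCMField.complexConj L) 3)) : (quasiSplit (↥(maximalRealSubfield L)) L (IsCMField.complexConj L) 3).Adelic) * k)) ∘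
          (InfiniteAdeleRing.ringEquiv_mixedSpace ↥(maximalRealSubfield L)).symm) s‖ ≤
          Cφ * ((borelHeight (((quasiSplit (↥(maximalRealSubfield L)) L (IsCMField.complexConj L) 3).toAdelic (weylLongU ((IsCMField.complexConj L : L ≃ₐ[↥(maximalRealSubfield L)] L) : L →+* L) (rfl : ((StdForm.antidiagonal 3).over L) = ((StdForm.antidiagonal 3).over L)))) *
          ((heisChart hc (X, traceZeroLine ↥(maximalRealSubfield L) L (IsCMField.complexConj L) hcδ hδ ((((InfiniteAdeleRing.ringEquiv_mixedSpace ↥(maximalRealSubfield L)).symm s), b) : AdeleRing (𝓞 ↥(maximalRealSubfield L)) ↥(maximalRealSubfield L))) : ↥(adelicUnipotent ↥(maximalRealSubfield L) L (IsCMField.complexConj L) 3)) :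
            (quasiSplit (↥(maximalRealSubfield L)) L (IsCMField.complexConj L) 3).Adelic) * k) : ℝ)) ^ z.re)
    (hφarchZ : ∀ z ∈ Kc, ∀ k ∈ ((standardMaximalCompactGL 3 L).comap (adelicVal ↥(maximalRealSubfield L) L (IsCMField.complexConj L) 3 ((StdForm.antidiagonal 3).over L)) : Subgroup (quasiSplit (↥(maximalRealSubfield L)) L (IsCMField.complexConj L) 3).Adelic), ∀ B : FiniteAdeleRing (𝓞 L) L,
      ContDiff ℝ m ((fun a : InfiniteAdeleRing L => ((μF (adeleFundamentalDomain ↥(maximalRealSubfield L))).toReal⁻¹ : ℂ) *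
          ∫ t, flatSectionU φ z (((quasiSplit (↥(maximalRealSubfield L)) L (IsCMField.complexConj L) 3).toAdelic (weylLongU ((IsCMField.complexConj L : L ≃ₐ[↥(maximalRealSubfield L)] L) : L →+* L) (rfl : ((StdForm.antidiagonal 3).over L) = ((StdForm.antidiagonal 3).over L)))) *
            ((heisChart hc (((a, B) : AdeleRing (𝓞 L) L), traceZeroLine ↥(maximalRealSubfield L) L (IsCMField.complexConj L) hcδ hδ t) : ↥(adelicUnipotent ↥(maximalRealSubfield L) L (IsCMField.complexConj L) 3)) : (quasiSplit (↥(maximalRealSubfield L)) L (IsCMField.complexConj L) 3).Adelic) * k) ∂μF) ∘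
        (InfiniteAdeleRing.ringEquiv_mixedSpace L).symm) ∧
      ∀ j : ℕ, j ≤ m → ∀ s : mixedSpace L,
        ‖iteratedFDeriv ℝ j ((fun a : InfiniteAdeleRing L => ((μF (adeleFundamentalDomain ↥(maximalRealSubfield L))).toReal⁻¹ : ℂ) *
          ∫ t, flatSectionU φ z (((quasiSplit (↥(maximalRealSubfield L)) L (IsCMField.complexConj L) 3).toAdelic (weylLongU ((IsCMField.complexConj L : L ≃ₐ[↥(maximalRealSubfield L)] L) : L →+* L) (rfl : ((StdForm.antidiagonal 3).over L) = ((StdForm.antidiagonal 3).over L)))) *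
            ((heisChart hc (((a, B) : AdeleRing (𝓞 L) L), traceZeroLine ↥(maximalRealSubfield L) L (IsCMField.complexConj L) hcδ hδ t) : ↥(adelicUnipotent ↥(maximalRealSubfield L) L (IsCMField.complexConj L) 3)) : (quasiSplit (↥(maximalRealSubfield L)) L (IsCMField.complexConj L) 3).Adelic) * k) ∂μF) ∘
          (InfiniteAdeleRing.ringEquiv_mixedSpace L).symm) s‖ ≤
          ∫ t, Cφ * ((borelHeight (((quasiSplit (↥(maximalRealSubfield L)) L (IsCMField.complexConj L) 3).toAdelic (weylLongU ((IsCMField.complexConj L : L ≃ₐ[↥(maximalRealSubfield L)] L) : L →+* L) (rfl : ((StdForm.antidiagonal 3).over L) = ((StdForm.antidiagonal 3).over L)))) *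
            ((heisChart hc (((((InfiniteAdeleRing.ringEquiv_mixedSpace L).symm s), B) : AdeleRing (𝓞 L) L), traceZeroLine ↥(maximalRealSubfield L) L (IsCMField.complexConj L) hcδ hδ t) : ↥(adelicUnipotent ↥(maximalRealSubfield L) L (IsCMField.complexConj L) 3)) :
              (quasiSplit (↥(maximalRealSubfield L)) L (IsCMField.complexConj L) 3).Adelic) * k) : ℝ)) ^ z.re ∂μF) :
    ∃ M₁ : ℝ, ∀ z ∈ Kc, ∀ g : (quasiSplit (↥(maximalRealSubfield L)) L (IsCMField.complexConj L) 3).Adelic, T < borelHeight g →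
      ‖eisensteinSeriesU (flatSectionU φ z) g - borelConstantTerm ν 𝓕 (eisensteinSeriesU (flatSectionU φ z)) g‖ ≤ M₁ := by
  classical
  -- the CM pair, the compact `K_U`, Iwasawa, heights on `K_U`, the unipotent Haar measure (all `z`-free)
  haveI : Algebra.IsQuadraticExtension ↥(maximalRealSubfield L) L := IsCMField.isQuadraticExtension L
  have hc1 : IsCMField.complexConj L ≠ 1 := IsCMField.complexConj_ne_one L
  have hKU : IsCompact (((standardMaximalCompactGL 3 L).comap (adelicVal ↥(maximalRealSubfield L) L (IsCMField.complexConj L) 3 ((StdForm.antidiagonal 3).over L)) : Subgroup (quasiSplit (↥(maximalRealSubfield L)) L (IsCMField.complexConj L) 3).Adelic) : Set (quasiSplit (↥(maximalRealSubfield L)) L (IsCMField.complexConj L) 3).Adelic) :=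
    isCompact_comap_adelicVal_standardMaximalCompactGL
  have hIw' : ∀ g : (quasiSplit (↥(maximalRealSubfield L)) L (IsCMField.complexConj L) 3).Adelic, ∃ b ∈ borelAdelic ↥(maximalRealSubfield L) L (IsCMField.complexConj L) 3, ∃ k ∈ (((standardMaximalCompactGL 3 L).comap (adelicVal ↥(maximalRealSubfield L) L (IsCMField.complexConj L) 3 ((StdForm.antidiagonal 3).over L)) : Subgroup (quasiSplit (↥(maximalRealSubfield L)) L (IsCMField.complexConj L) 3).Adelic) : Set (quasiSplit (↥(maximalRealSubfield L)) L (IsCMField.complexConj L) 3).Adelic), g = b * k := fun g => by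
    obtain ⟨b, hb, k, hk, hg⟩ := exists_mem_borelAdelic_mul_mem_standardMaximalCompactGL_cm_three L g
    exact ⟨b, hb, k, Subgroup.mem_comap.2 hk, hg⟩
  have hIw := exists_heisChart_torus_of_borel_mul_three hc hcδ hδ hIw'
  have hK : ∀ k ∈ (((standardMaximalCompactGL 3 L).comap (adelicVal ↥(maximalRealSubfield L) L (IsCMField.complexConj L) 3 ((StdForm.antidiagonal 3).over L)) : Subgroup (quasiSplit (↥(maximalRealSubfield L)) L (IsCMField.complexConj L) 3).Adelic) : Set (quasiSplit (↥(maximalRealSubfield L)) L (IsCMField.complexConj L) 3).Adelic), (borelHeight k : ℝ) ≤ (T : ℝ) := fun k hk => by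
    rw [borelHeight_eq_one_of_mem_maximalCompact hk, NNReal.coe_one]; exact_mod_cast hT
  obtain ⟨h𝓕₀, h𝓕top⟩ := measure_fundamentalDomain_ne_zero_and_ne_top_three hc ν h𝓕
  haveI := isInvInvariant_of_isHaarMeasure_adelicUnipotent_three hc ν
  -- right-`U₀`-invariance: elements of the level lie in `K_U`
  have hmemK : ∀ u : (quasiSplit (↥(maximalRealSubfield L)) L (IsCMField.complexConj L) 3).Adelic, adelicVal ↥(maximalRealSubfield L) L (IsCMField.complexConj L) 3 ((StdForm.antidiagonal 3).over L) u ∈ U₀.map (GLn.ofFinite 3 L) →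
      u ∈ ((standardMaximalCompactGL 3 L).comap (adelicVal ↥(maximalRealSubfield L) L (IsCMField.complexConj L) 3 ((StdForm.antidiagonal 3).over L)) : Subgroup (quasiSplit (↥(maximalRealSubfield L)) L (IsCMField.complexConj L) 3).Adelic) := by
    intro u hu
    obtain ⟨w, hw, hwu⟩ := Subgroup.mem_map.1 hu
    exact Subgroup.mem_comap.2 (by rw [← hwu]; exact glIntegralLevel_le_standardMaximalCompactGL (GLn.ofFinite_mem_glIntegralLevel (hU₀K hw)))
  -- degrees: `[L⁺:ℚ] < m`, `2 ≤ Re z + m∕[L:ℚ]`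
  have hdF : (finrank ℚ ↥(maximalRealSubfield L) : ℝ) < m := by
    have h2 := Module.finrank_mul_finrank ℚ ↥(maximalRealSubfield L) L
    rw [Algebra.IsQuadraticExtension.finrank_eq_two ↥(maximalRealSubfield L) L] at h2
    have hle : (finrank ℚ ↥(maximalRealSubfield L) : ℝ) ≤ (finrank ℚ L : ℝ) := by exact_mod_cast (by omega : finrank ℚ ↥(maximalRealSubfield L) ≤ finrank ℚ L)
    exact hle.trans_lt hm
  have hd : 0 < (finrank ℚ L : ℝ) := Nat.cast_pos.2 finrank_pos
  -- THE z-FREE CONSTANTS: PART II (★ U1), the masses and the shell (U3a, §1), the decay constants (★ U2), `M₁`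
  obtain ⟨C'F, hC'F, hPartF⟩ := exists_const_fibre_majorant_centre_of_archSmooth_three hc hcδ hδ μF μF₁ μF₂ hKU hU₀o m
  obtain ⟨C'E, hC'E, hPartE⟩ := exists_const_fibre_majorant_centreAverage_of_archSmooth_three hc hcδ hδ μF μE μE₁ μE₂ hKU hU₀o m
  obtain ⟨N, BF, θ, hN0, hBF, hθ, hmass, hshell⟩ := exists_uniform_centreLine_mass_and_shell_cm_three L hc hcδ hδ μF hKc hKc2 hCφ hm
  obtain ⟨NE, hNE⟩ := exists_uniform_centreAverage_mass_cm_three L hc hcδ hδ ν h𝓕 h𝓕c μF μE hKc hKc2 hCφ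
  have hN₂E : 0 ≤ C'E * max NE 0 := mul_nonneg hC'E (le_max_right _ _)
  have hshell' : ∀ k ∈ ((standardMaximalCompactGL 3 L).comap (adelicVal ↥(maximalRealSubfield L) L (IsCMField.complexConj L) 3 ((StdForm.antidiagonal 3).over L)) : Subgroup (quasiSplit (↥(maximalRealSubfield L)) L (IsCMField.complexConj L) 3).Adelic), ∀ (l₁ : (AdeleRing (𝓞 L) L)ˣ) (l₂ : (AdeleRing (𝓞 ↥(maximalRealSubfield L)) ↥(maximalRealSubfield L))ˣ) (Y : AdeleRing (𝓞 L) L), ((IdeleClassGroup.ideleNorm ↥(maximalRealSubfield L) l₂ : ℝ≥0) : ℝ) ≤ 1 → ((IdeleClassGroup.ideleNorm L l₁ : ℝ≥0) : ℝ) = ((IdeleClassGroup.ideleNorm ↥(maximalRealSubfield L) l₂ : ℝ≥0) : ℝ) →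
      (Summable fun x₀ : L => C'F * N ((l₁ : AdeleRing (𝓞 L) L) * (algebraMap L (AdeleRing (𝓞 L) L) x₀ - Y))) ∧
      ∑' x₀ : L, C'F * N ((l₁ : AdeleRing (𝓞 L) L) * (algebraMap L (AdeleRing (𝓞 L) L) x₀ - Y)) ≤ C'F * BF * (((IdeleClassGroup.ideleNorm ↥(maximalRealSubfield L) l₂ : ℝ≥0) : ℝ)⁻¹) ^ θ := by
    intro k _ l₁ l₂ Y hl₂ hl
    obtain ⟨hs, hle⟩ := hshell l₁ l₂ Y hl₂ hl
    refine ⟨hs.mul_left C'F, ?_⟩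
    rw [tsum_mul_left, mul_assoc]
    exact mul_le_mul_of_nonneg_left hle hC'F
  obtain ⟨CE, hCE, hdecEf⟩ := exists_forall_fourierDecay_centreAverage_three hc hcδ hδ μF μE μE₁ μE₂ hKU hU₀o hm hN₂E
  obtain ⟨B, hB, hdecFf⟩ := exists_forall_fourierDecay_centreLine_shell_three hc hcδ hδ μF μF₁ μF₂ hKU hU₀o hdF (mul_nonneg hC'F hBF)
  refine ⟨(μF (adeleFundamentalDomain ↥(maximalRealSubfield L))).toReal⁻¹ * B + (μE (adeleFundamentalDomain L)).toReal⁻¹ * CE, fun z hzK g hg => ?_⟩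
  -- PER `z ∈ Kc`: the letters `f_z = flatSectionU φ z` (as in ★ A)
  have hz : 2 < z.re := hKc2 z hzK
  have hfc : Continuous (flatSectionU φ z) := continuous_flatSectionU hφc z
  have hfm : Measurable (flatSectionU φ z) := hfc.measurable
  have hfB := flatSectionU_toAdelic_mul hφB z
  have hfN := unipotent_mul_of_borelLaw_diagUnit χ z (hf z hzK)
  have hfU : ∀ u : (quasiSplit (↥(maximalRealSubfield L)) L (IsCMField.complexConj L) 3).Adelic, adelicVal ↥(maximalRealSubfield L) L (IsCMField.complexConj L) 3 ((StdForm.antidiagonal 3).over L) u ∈ U₀.map (GLn.ofFinite 3 L) →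
      ∀ y : (quasiSplit (↥(maximalRealSubfield L)) L (IsCMField.complexConj L) 3).Adelic, flatSectionU φ z (y * u) = flatSectionU φ z y := by
    intro u hu y
    rw [flatSectionU_apply, flatSectionU_apply, hφU u hu y, borelHeight_mul_of_mem_comap_standardMaximalCompactGL (hmemK u hu) y]
  have h𝓔U : ∀ u : (quasiSplit (↥(maximalRealSubfield L)) L (IsCMField.complexConj L) 3).Adelic, adelicVal ↥(maximalRealSubfield L) L (IsCMField.complexConj L) 3 ((StdForm.antidiagonal 3).over L) u ∈ U₀.map (GLn.ofFinite 3 L) →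
      ∀ y : (quasiSplit (↥(maximalRealSubfield L)) L (IsCMField.complexConj L) 3).Adelic,
        (fun x : (quasiSplit (↥(maximalRealSubfield L)) L (IsCMField.complexConj L) 3).Adelic => Cφ * ((borelHeight x : ℝ)) ^ z.re) (y * u) =
          (fun x : (quasiSplit (↥(maximalRealSubfield L)) L (IsCMField.complexConj L) 3).Adelic => Cφ * ((borelHeight x : ℝ)) ^ z.re) y := by
    intro u hu y
    simp only [borelHeight_mul_of_mem_comap_standardMaximalCompactGL (hmemK u hu) y]
  -- Godement at the CM pair (`2 < Re z`): the locally uniform majorant, `hfin`, `hs`, `hsumN`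
  have hmaj := fun y₀ : (quasiSplit (↥(maximalRealSubfield L)) L (IsCMField.complexConj L) 3).Adelic => exists_locallyUniform_majorant_flatSectionU_cm_three L hz hφM y₀
  have hcont : ∀ q : Quotient (orbitRel ↥(borelU ((IsCMField.complexConj L : L ≃ₐ[↥(maximalRealSubfield L)] L) : L →+* L) ((StdForm.antidiagonal 3).over L)) ↥(unitaryGroupOfForm ((IsCMField.complexConj L : L ≃ₐ[↥(maximalRealSubfield L)] L) : L →+* L) ((StdForm.antidiagonal 3).over L))),
      Continuous fun y : (quasiSplit (↥(maximalRealSubfield L)) L (IsCMField.complexConj L) 3).Adelic => flatSectionU φ z ((quasiSplit (↥(maximalRealSubfield L)) L (IsCMField.complexConj L) 3).toAdelic (q.out : ↥(unitaryGroupOfForm ((IsCMField.complexConj L : L ≃ₐ[↥(maximalRealSubfield L)] L) : L →+* L) ((StdForm.antidiagonal 3).over L))) * y) :=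
    fun q => hfc.comp (continuous_const.mul continuous_id)
  have hfin := fun g : (quasiSplit (↥(maximalRealSubfield L)) L (IsCMField.complexConj L) 3).Adelic => hfin_of_locallyUniformMajorant ν hfB hcont hmaj h𝓕c g
  have hs := fun g : (quasiSplit (↥(maximalRealSubfield L)) L (IsCMField.complexConj L) 3).Adelic => (summable_eisensteinSeriesU_flatSectionU_cm_three L hz hφM g).of_norm
  have hsumN := fun g : (quasiSplit (↥(maximalRealSubfield L)) L (IsCMField.complexConj L) 3).Adelic => summable_norm_weylLongU_heisChart_rat_three hc hcδ hδ hfB hmaj g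
  -- the two-layer Poisson binders (★ FILE A ∕ FILE B)
  have hΦc : ∀ (g : (quasiSplit (↥(maximalRealSubfield L)) L (IsCMField.complexConj L) 3).Adelic) (x₀ : L), Continuous fun s : (AdeleRing (𝓞 ↥(maximalRealSubfield L)) ↥(maximalRealSubfield L)) =>
      flatSectionU φ z (((quasiSplit (↥(maximalRealSubfield L)) L (IsCMField.complexConj L) 3).toAdelic (weylLongU ((IsCMField.complexConj L : L ≃ₐ[↥(maximalRealSubfield L)] L) : L →+* L) (rfl : ((StdForm.antidiagonal 3).over L) = ((StdForm.antidiagonal 3).over L)))) * ((heisChart hc (algebraMap L (AdeleRing (𝓞 L) L) x₀, traceZeroLine ↥(maximalRealSubfield L) L (IsCMField.complexConj L) hcδ hδ s) : ↥(adelicUnipotent ↥(maximalRealSubfield L) L (IsCMField.complexConj L) 3)) : (quasiSplit (↥(maximalRealSubfield L)) L (IsCMField.complexConj L) 3).Adelic) * g) := fun g x₀ =>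
    hfc.comp ((continuous_const.mul (continuous_subtype_val.comp ((heisChart hc).continuous.comp
      (continuous_const.prodMk (traceZeroLine ↥(maximalRealSubfield L) L (IsCMField.complexConj L) hcδ hδ).continuous)))).mul continuous_const)
  have hΦi : ∀ (g : (quasiSplit (↥(maximalRealSubfield L)) L (IsCMField.complexConj L) 3).Adelic) (x₀ : L), Integrable (fun s : (AdeleRing (𝓞 ↥(maximalRealSubfield L)) ↥(maximalRealSubfield L)) =>
      flatSectionU φ z (((quasiSplit (↥(maximalRealSubfield L)) L (IsCMField.complexConj L) 3).toAdelic (weylLongU ((IsCMField.complexConj L : L ≃ₐ[↥(maximalRealSubfield L)] L) : L →+* L) (rfl : ((StdForm.antidiagonal 3).over L) = ((StdForm.antidiagonal 3).over L)))) * ((heisChart hc (algebraMap L (AdeleRing (𝓞 L) L) x₀, traceZeroLine ↥(maximalRealSubfield L) L (IsCMField.complexConj L) hcδ hδ s) : ↥(adelicUnipotent ↥(maximalRealSubfield L) L (IsCMField.complexConj L) 3)) : (quasiSplit (↥(maximalRealSubfield L)) L (IsCMField.complexConj L) 3).Adelic) * g)) μF := fun g x₀ =>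
    integrable_centreLine_three hc hcδ hδ μF hfc hfB hmaj _ g
  have hloc : ∀ (g : (quasiSplit (↥(maximalRealSubfield L)) L (IsCMField.complexConj L) 3).Adelic) (x₀ : L) (C₀ : Set (AdeleRing (𝓞 ↥(maximalRealSubfield L)) ↥(maximalRealSubfield L))), IsCompact C₀ → ∃ u : ↥(maximalRealSubfield L) → ℝ, Summable u ∧
      ∀ x ∈ C₀, ∀ ξ : ↥(maximalRealSubfield L), ‖flatSectionU φ z (((quasiSplit (↥(maximalRealSubfield L)) L (IsCMField.complexConj L) 3).toAdelic (weylLongU ((IsCMField.complexConj L : L ≃ₐ[↥(maximalRealSubfield L)] L) : L →+* L) (rfl : ((StdForm.antidiagonal 3).over L) = ((StdForm.antidiagonal 3).over L)))) * ((heisChart hc (algebraMap L (AdeleRing (𝓞 L) L) x₀, traceZeroLine ↥(maximalRealSubfield L) L (IsCMField.complexConj L) hcδ hδ (x + algebraMap ↥(maximalRealSubfield L) (AdeleRing (𝓞 ↥(maximalRealSubfield L)) ↥(maximalRealSubfield L)) ξ)) : ↥(adelicUnipotent ↥(maximalRealSubfield L) L (IsCMField.complexConj L) 3)) : (quasiSplit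 (↥(maximalRealSubfield L)) L (IsCMField.complexConj L) 3).Adelic) * g)‖ ≤ u ξ :=
    fun g x₀ C₀ hC₀ => exists_summable_majorant_centre_translate_three' hc hcδ hδ hfB hmaj _ hC₀ g
  have hΦZc := fun g : (quasiSplit (↥(maximalRealSubfield L)) L (IsCMField.complexConj L) 3).Adelic => continuous_centreAverage_three hc hcδ hδ μF hfc hfB hmaj g
  have hΦZi := fun g : (quasiSplit (↥(maximalRealSubfield L)) L (IsCMField.complexConj L) 3).Adelic => integrable_centreAverage_three hc hcδ hδ μF μE hfc hfB hmaj g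
  have hlocZ : ∀ (g : (quasiSplit (↥(maximalRealSubfield L)) L (IsCMField.complexConj L) 3).Adelic) (C₀ : Set (AdeleRing (𝓞 L) L)), IsCompact C₀ → ∃ u : L → ℝ, Summable u ∧
      ∀ x ∈ C₀, ∀ ξ : L, ‖((μF (adeleFundamentalDomain ↥(maximalRealSubfield L))).toReal⁻¹ : ℂ) * ∫ s, flatSectionU φ z (((quasiSplit (↥(maximalRealSubfield L)) L (IsCMField.complexConj L) 3).toAdelic (weylLongU ((IsCMField.complexConj L : L ≃ₐ[↥(maximalRealSubfield L)] L) : L →+* L) (rfl : ((StdForm.antidiagonal 3).over L) = ((StdForm.antidiagonal 3).over L)))) * ((heisChart hc ((x + algebraMap L (AdeleRing (𝓞 L) L) ξ), traceZeroLine ↥(maximalRealSubfield L) L (IsCMField.complexConj L) hcδ hδ s) : ↥(adelicUnipotent ↥(maximalRealSubfield L) L (IsCMField.complexConj L) 3)) : (quasiSplit (↥(maximalRealSubfield L)) L (IsCMField.complexConj L) 3).Adelic) * g) ∂μF‖ ≤ u ξ :=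
    fun g C₀ hC₀ => by
    obtain ⟨u, -, hu, hle⟩ := exists_summable_majorant_centreAverage_translate_three hc hcδ hδ μF hfB hmaj hC₀ g
    exact ⟨u, hu, hle⟩
  -- `hnorm` (★ (ν-1)): the big-cell translates of `f_z` are `ν`-integrable (★ [D8] for the constant section + `‖f_z‖ ≤ M_φ · H^(Re z)`)
  have hmaj₁ := fun y₀ : (quasiSplit (↥(maximalRealSubfield L)) L (IsCMField.complexConj L) 3).Adelic =>
    exists_locallyUniform_majorant_flatSectionU_cm_three L hz (φ := fun _ : (quasiSplit (↥(maximalRealSubfield L)) L (IsCMField.complexConj L) 3).Adelic => (1 : ℂ)) (M := 1) (fun _ => le_of_eq norm_one) y₀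
  have hfB₁ := flatSectionU_toAdelic_mul (c := IsCMField.complexConj L) (N := 3) (φ := fun _ : (quasiSplit (↥(maximalRealSubfield L)) L (IsCMField.complexConj L) 3).Adelic => (1 : ℂ)) (fun _ _ _ => rfl) z
  have hcont₁ : ∀ q : Quotient (orbitRel ↥(borelU ((IsCMField.complexConj L : L ≃ₐ[↥(maximalRealSubfield L)] L) : L →+* L) ((StdForm.antidiagonal 3).over L)) ↥(unitaryGroupOfForm ((IsCMField.complexConj L : L ≃ₐ[↥(maximalRealSubfield L)] L) : L →+* L) ((StdForm.antidiagonal 3).over L))),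
      Continuous fun y : (quasiSplit (↥(maximalRealSubfield L)) L (IsCMField.complexConj L) 3).Adelic => flatSectionU (fun _ : (quasiSplit (↥(maximalRealSubfield L)) L (IsCMField.complexConj L) 3).Adelic => (1 : ℂ)) z ((quasiSplit (↥(maximalRealSubfield L)) L (IsCMField.complexConj L) 3).toAdelic (q.out : ↥(unitaryGroupOfForm ((IsCMField.complexConj L : L ≃ₐ[↥(maximalRealSubfield L)] L) : L →+* L) ((StdForm.antidiagonal 3).over L))) * y) :=
    fun q => (continuous_flatSectionU continuous_const z).comp (continuous_const.mul continuous_id)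
  have hint : ∀ g : (quasiSplit (↥(maximalRealSubfield L)) L (IsCMField.complexConj L) 3).Adelic, Integrable (fun v : ↥(adelicUnipotent ↥(maximalRealSubfield L) L (IsCMField.complexConj L) 3) => flatSectionU φ z (((quasiSplit (↥(maximalRealSubfield L)) L (IsCMField.complexConj L) 3).toAdelic (weylLongU ((IsCMField.complexConj L : L ≃ₐ[↥(maximalRealSubfield L)] L) : L →+* L) (rfl : ((StdForm.antidiagonal 3).over L) = ((StdForm.antidiagonal 3).over L)))) * (v : (quasiSplit (↥(maximalRealSubfield L)) L (IsCMField.complexConj L) 3).Adelic) * g)) ν := fun g => by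
    have hD8 := integrable_borelHeight_weylLongU_mul_rpow ν h𝓕 z g (hfin_of_locallyUniformMajorant ν hfB₁ hcont₁ hmaj₁ h𝓕c g)
    refine (hD8.const_mul Mφ).mono' (hfc.comp ((continuous_const.mul continuous_subtype_val).mul continuous_const)).aestronglyMeasurable
      (Eventually.of_forall fun v => ?_)
    have hH : 0 < ((borelHeight (((quasiSplit (↥(maximalRealSubfield L)) L (IsCMField.complexConj L) 3).toAdelic (weylLongU ((IsCMField.complexConj L : L ≃ₐ[↥(maximalRealSubfield L)] L) : L →+* L) (rfl : ((StdForm.antidiagonal 3).over L) = ((StdForm.antidiagonal 3).over L)))) * ((v : (quasiSplit (↥(maximalRealSubfield L)) L (IsCMField.complexConj L) 3).Adelic) * g)) : ℝ≥0) : ℝ) := NNReal.coe_pos.2 (borelHeight_pos _)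
    rw [mul_assoc, flatSectionU_apply, norm_mul, Complex.norm_cpow_eq_rpow_re_of_pos hH]
    exact mul_le_mul_of_nonneg_right (hφM _) (Real.rpow_nonneg hH.le _)
  have hnorm := forall_inv_measure_smul_integral_weylLongU_eq_three hcδ hδ hc μF μE ν h𝓕 (flatSectionU φ z) hint
  -- the fibrewise archimedean triples at this `z` (★ U1, envelope `C_φ·H^{Re z}`) and the decay binders (★ U2) with the z-FREE constants
  obtain ⟨AF, hAF, hdecArchF⟩ := @hPartF (flatSectionU φ z) (fun x : (quasiSplit (↥(maximalRealSubfield L)) L (IsCMField.complexConj L) 3).Adelic => Cφ * ((borelHeight x : ℝ)) ^ z.re)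
    h𝓔U N (fun k hk X => (hmass z hzK k hk X).1) (fun k hk X => (hmass z hzK k hk X).2) (hφarch z hzK)
  obtain ⟨AE, hAE, hdecArchE⟩ := @hPartE (flatSectionU φ z) (fun x : (quasiSplit (↥(maximalRealSubfield L)) L (IsCMField.complexConj L) 3).Adelic => Cφ * ((borelHeight x : ℝ)) ^ z.re)
    h𝓔U (fun k hk => (hNE z hzK k hk).1) NE (fun k hk => (hNE z hzK k hk).2) (hφarchZ z hzK)
  have hdecE := @hdecEf (flatSectionU φ z) hfc hfB hmaj hfU AE hAE hdecArchE
  have hdecF := @hdecFf (flatSectionU φ z) hfc hfB hmaj hfU AF (fun _ X => C'F * N X) (fun k _ X => mul_nonneg hC'F (hN0 X)) hAF hdecArchF θ hshell'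
  have hσE : 2 ≤ z.re + (m : ℝ) / (finrank ℚ L : ℝ) := le_add_of_le_of_nonneg hz.le (div_nonneg (Nat.cast_nonneg m) hd.le)
  -- ★ R6d₃ assembled at this `z` with the `z`-free constants `B`, `C_E`
  have hg' : (T : ℝ) < (borelHeight g : ℝ) := by exact_mod_cast hg
  exact forall_norm_sub_borelConstantTerm_le_three hc hcδ hδ ν χ hχ z hfm hfN hfB (hf z hzK) h𝓕 h𝓕₀ h𝓕top μF μE hB hCE (hθ z hzK) hσE hK hIw
    hfin hs hsumN hΦc hΦi hloc hΦZc hΦZi hlocZ hnorm hdecF hdecE g hg'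

/-! ## §3 `Λ^T E(f_z)` bounded on `U(2,1)(𝔸)`, uniformly on `Kc` -/

/-- **`Λ^T E(f_z)` IS BOUNDED ON `U(2,1)(𝔸)` OVER A CM FIELD, UNIFORMLY FOR `z` IN A COMPACT `Kc ⊂ {2 < Re z}`**, from the archimedean binders `hφarch` ∕ `hφarchZ` with ONE `C_φ`:
`∃ M, ∀ z ∈ Kc, ∀ g, ‖Λ^T E(f_z)(g)‖ ≤ M` — §2 composed with ★ (R6g-a)₃ `exists_norm_truncation_eisensteinSeriesU_flatSectionU_le_uniform_cm_three` (its `hdec`).  The `hdec′` ∕ `hdecU` survivor of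
the N = 3 Maass–Selberg capstone. [cite: MoeglinWaldspurger1995, I.2.13, IV.2] [cite: Arthur1980TraceFormulaII, §4] [cite: Garrett2018, §2.10–§2.11] -/
theorem exists_norm_truncation_flatSectionU_le_level_cm_three_uniform_of_archSmooth {δ : L} (hc : IsCMField.complexConj L * IsCMField.complexConj L = 1) (hcδ : IsCMField.complexConj L δ = -δ) (hδ : δ ≠ 0)
    (ν : Measure ↥(adelicUnipotent ↥(maximalRealSubfield L) L (IsCMField.complexConj L) 3)) [ν.IsHaarMeasure]
    {𝓕 : Set ↥(adelicUnipotent ↥(maximalRealSubfield L) L (IsCMField.complexConj L) 3)} (h𝓕 : IsFundamentalDomain ↥(rationalUnipotent ↥(maximalRealSubfield L) L (IsCMField.complexConj L) 3) 𝓕 ν) (h𝓕c : IsCompact (closure 𝓕))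
    (μF : Measure (AdeleRing (𝓞 ↥(maximalRealSubfield L)) ↥(maximalRealSubfield L))) [μF.IsAddHaarMeasure] (μF₁ : Measure (InfiniteAdeleRing ↥(maximalRealSubfield L))) [μF₁.IsAddHaarMeasure]
    (μF₂ : Measure (FiniteAdeleRing (𝓞 ↥(maximalRealSubfield L)) ↥(maximalRealSubfield L))) [μF₂.IsAddHaarMeasure]
    (μE : Measure (AdeleRing (𝓞 L) L)) [μE.IsAddHaarMeasure] (μE₁ : Measure (InfiniteAdeleRing L)) [μE₁.IsAddHaarMeasure]
    (μE₂ : Measure (FiniteAdeleRing (𝓞 L) L)) [μE₂.IsAddHaarMeasure]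
    (χ : HeckeCharacter L) (hχ : χ.IsUnitary) {Kc : Set ℂ} (hKc : IsCompact Kc) (hKc2 : ∀ z ∈ Kc, 2 < z.re)
    {φ : (quasiSplit (↥(maximalRealSubfield L)) L (IsCMField.complexConj L) 3).Adelic → ℂ} (hφc : Continuous φ) {Mφ : ℝ} (hφM : ∀ x, ‖φ x‖ ≤ Mφ)
    (hφB : ∀ b ∈ borelU ((IsCMField.complexConj L : L ≃ₐ[↥(maximalRealSubfield L)] L) : L →+* L) ((StdForm.antidiagonal 3).over L), ∀ x : (quasiSplit (↥(maximalRealSubfield L)) L (IsCMField.complexConj L) 3).Adelic, φ ((quasiSplit (↥(maximalRealSubfield L)) L (IsCMField.complexConj L) 3).toAdelic b * x) = φ x)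
    (hf : ∀ z ∈ Kc, ∀ (b g : (quasiSplit (↥(maximalRealSubfield L)) L (IsCMField.complexConj L) 3).Adelic) (hb : b ∈ borelAdelic ↥(maximalRealSubfield L) L (IsCMField.complexConj L) 3),
      flatSectionU φ z (b * g) = ((χ (diagUnit hb 0) : ℂˣ) : ℂ) * ((ideleNorm (diagUnit hb 0) : ℝ) : ℂ) ^ z * flatSectionU φ z g)
    {U₀ : Subgroup (GL (Fin 3) (FiniteAdeleRing (𝓞 L) L))} (hU₀o : IsOpen (U₀ : Set (GL (Fin 3) (FiniteAdeleRing (𝓞 L) L)))) (hU₀K : U₀ ≤ glFiniteIntegralLevel 3 L)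
    (hφU : ∀ u : (quasiSplit (↥(maximalRealSubfield L)) L (IsCMField.complexConj L) 3).Adelic, adelicVal ↥(maximalRealSubfield L) L (IsCMField.complexConj L) 3 ((StdForm.antidiagonal 3).over L) u ∈ U₀.map (GLn.ofFinite 3 L) → ∀ y : (quasiSplit (↥(maximalRealSubfield L)) L (IsCMField.complexConj L) 3).Adelic, φ (y * u) = φ y)
    {T : ℝ≥0} (hT : 1 ≤ T) {m : ℕ} (hm : (finrank ℚ L : ℝ) < m) {Cφ : ℝ} (hCφ : 0 ≤ Cφ)
    -- the archimedean smoothness binders of ★ PART II for EVERY `z ∈ Kc`, ONE constant `C_φ`, envelope `C_φ·H^{Re z}` (payer: K2E1-p08 (g5) (a3)₃ ∕ (q11))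
    (hφarch : ∀ z ∈ Kc, ∀ k ∈ ((standardMaximalCompactGL 3 L).comap (adelicVal ↥(maximalRealSubfield L) L (IsCMField.complexConj L) 3 ((StdForm.antidiagonal 3).over L)) : Subgroup (quasiSplit (↥(maximalRealSubfield L)) L (IsCMField.complexConj L) 3).Adelic), ∀ (X : AdeleRing (𝓞 L) L) (b : FiniteAdeleRing (𝓞 ↥(maximalRealSubfield L)) ↥(maximalRealSubfield L)),
      ContDiff ℝ m ((fun a : InfiniteAdeleRing ↥(maximalRealSubfield L) => flatSectionU φ z (((quasiSplit (↥(maximalRealSubfield L)) L (IsCMField.complexConj L) 3).toAdelic (weylLongU ((IsCMField.complexConj L : L ≃ₐ[↥(maximalRealSubfield L)] L) : L →+* L) (rfl : ((StdForm.antidiagonal 3).over L) = ((StdForm.antidiagonal 3).over L)))) *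
          ((heisChart hc (X, traceZeroLine ↥(maximalRealSubfield L) L (IsCMField.complexConj L) hcδ hδ ((a, b) : AdeleRing (𝓞 ↥(maximalRealSubfield L)) ↥(maximalRealSubfield L))) : ↥(adelicUnipotent ↥(maximalRealSubfield L) L (IsCMField.complexConj L) 3)) : (quasiSplit (↥(maximalRealSubfield L)) L (IsCMField.complexConj L) 3).Adelic) * k)) ∘
        (InfiniteAdeleRing.ringEquiv_mixedSpace ↥(maximalRealSubfield L)).symm) ∧
      ∀ j : ℕ, j ≤ m → ∀ s : mixedSpace ↥(maximalRealSubfield L),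
        ‖iteratedFDeriv ℝ j ((fun a : InfiniteAdeleRing ↥(maximalRealSubfield L) => flatSectionU φ z (((quasiSplit (↥(maximalRealSubfield L)) L (IsCMField.complexConj L) 3).toAdelic (weylLongU ((IsCMField.complexConj L : L ≃ₐ[↥(maximalRealSubfield L)] L) : L →+* L) (rfl : ((StdForm.antidiagonal 3).over L) = ((StdForm.antidiagonal 3).over L)))) *
          ((heisChart hc (X, traceZeroLine ↥(maximalRealSubfield L) L (IsCMField.complexConj L) hcδ hδ ((a, b) : AdeleRing (𝓞 ↥(maximalRealSubfield L)) ↥(maximalRealSubfield L))) : ↥(adelicUnipotent ↥(maximalRealSubfield L) L (IsCMField.complexConj L) 3)) : (quasiSplit (↥(maximalRealSubfield L)) L (IsCMField.complexConj L) 3).Adelic) * k)) ∘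
          (InfiniteAdeleRing.ringEquiv_mixedSpace ↥(maximalRealSubfield L)).symm) s‖ ≤
          Cφ * ((borelHeight (((quasiSplit (↥(maximalRealSubfield L)) L (IsCMField.complexConj L) 3).toAdelic (weylLongU ((IsCMField.complexConj L : L ≃ₐ[↥(maximalRealSubfield L)] L) : L →+* L) (rfl : ((StdForm.antidiagonal 3).over L) = ((StdForm.antidiagonal 3).over L)))) *
          ((heisChart hc (X, traceZeroLine ↥(maximalRealSubfield L) L (IsCMField.complexConj L) hcδ hδ ((((InfiniteAdeleRing.ringEquiv_mixedSpace ↥(maximalRealSubfield L)).symm s), b) : AdeleRing (𝓞 ↥(maximalRealSubfield L)) ↥(maximalRealSubfield L))) : ↥(adelicUnipotent ↥(maximalRealSubfield L) L (IsCMField.complexConj L) 3)) :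
            (quasiSplit (↥(maximalRealSubfield L)) L (IsCMField.complexConj L) 3).Adelic) * k) : ℝ)) ^ z.re)
    (hφarchZ : ∀ z ∈ Kc, ∀ k ∈ ((standardMaximalCompactGL 3 L).comap (adelicVal ↥(maximalRealSubfield L) L (IsCMField.complexConj L) 3 ((StdForm.antidiagonal 3).over L)) : Subgroup (quasiSplit (↥(maximalRealSubfield L)) L (IsCMField.complexConj L) 3).Adelic), ∀ B : FiniteAdeleRing (𝓞 L) L,
      ContDiff ℝ m ((fun a : InfiniteAdeleRing L => ((μF (adeleFundamentalDomain ↥(maximalRealSubfield L))).toReal⁻¹ : ℂ) *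
          ∫ t, flatSectionU φ z (((quasiSplit (↥(maximalRealSubfield L)) L (IsCMField.complexConj L) 3).toAdelic (weylLongU ((IsCMField.complexConj L : L ≃ₐ[↥(maximalRealSubfield L)] L) : L →+* L) (rfl : ((StdForm.antidiagonal 3).over L) = ((StdForm.antidiagonal 3).over L)))) *
            ((heisChart hc (((a, B) : AdeleRing (𝓞 L) L), traceZeroLine ↥(maximalRealSubfield L) L (IsCMField.complexConj L) hcδ hδ t) : ↥(adelicUnipotent ↥(maximalRealSubfield L) L (IsCMField.complexConj L) 3)) : (quasiSplit (↥(maximalRealSubfield L)) L (IsCMField.complexConj L) 3).Adelic) * k) ∂μF) ∘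
        (InfiniteAdeleRing.ringEquiv_mixedSpace L).symm) ∧
      ∀ j : ℕ, j ≤ m → ∀ s : mixedSpace L,
        ‖iteratedFDeriv ℝ j ((fun a : InfiniteAdeleRing L => ((μF (adeleFundamentalDomain ↥(maximalRealSubfield L))).toReal⁻¹ : ℂ) *
          ∫ t, flatSectionU φ z (((quasiSplit (↥(maximalRealSubfield L)) L (IsCMField.complexConj L) 3).toAdelic (weylLongU ((IsCMField.complexConj L : L ≃ₐ[↥(maximalRealSubfield L)] L) : L →+* L) (rfl : ((StdForm.antidiagonal 3).over L) = ((StdForm.antidiagonal 3).over L)))) *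
            ((heisChart hc (((a, B) : AdeleRing (𝓞 L) L), traceZeroLine ↥(maximalRealSubfield L) L (IsCMField.complexConj L) hcδ hδ t) : ↥(adelicUnipotent ↥(maximalRealSubfield L) L (IsCMField.complexConj L) 3)) : (quasiSplit (↥(maximalRealSubfield L)) L (IsCMField.complexConj L) 3).Adelic) * k) ∂μF) ∘
          (InfiniteAdeleRing.ringEquiv_mixedSpace L).symm) s‖ ≤
          ∫ t, Cφ * ((borelHeight (((quasiSplit (↥(maximalRealSubfield L)) L (IsCMField.complexConj L) 3).toAdelic (weylLongU ((IsCMField.complexConj L : L ≃ₐ[↥(maximalRealSubfield L)] L) : L →+* L) (rfl : ((StdForm.antidiagonal 3).over L) = ((StdForm.antidiagonal 3).over L)))) *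
            ((heisChart hc (((((InfiniteAdeleRing.ringEquiv_mixedSpace L).symm s), B) : AdeleRing (𝓞 L) L), traceZeroLine ↥(maximalRealSubfield L) L (IsCMField.complexConj L) hcδ hδ t) : ↥(adelicUnipotent ↥(maximalRealSubfield L) L (IsCMField.complexConj L) 3)) :
              (quasiSplit (↥(maximalRealSubfield L)) L (IsCMField.complexConj L) 3).Adelic) * k) : ℝ)) ^ z.re ∂μF) :
    ∃ M : ℝ, ∀ z ∈ Kc, ∀ g : (quasiSplit (↥(maximalRealSubfield L)) L (IsCMField.complexConj L) 3).Adelic,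
      ‖truncation ν 𝓕 T (eisensteinSeriesU (flatSectionU φ z)) g‖ ≤ M := by
  obtain ⟨M₁, hM₁⟩ := exists_bound_sub_borelConstantTerm_level_cm_three_uniform_of_archSmooth L hc hcδ hδ ν h𝓕 h𝓕c μF μF₁ μF₂ μE μE₁ μE₂ χ hχ hKc hKc2 hφc hφM hφB hf
    hU₀o hU₀K hφU hT hm hCφ hφarch hφarchZ
  obtain ⟨M₀, h⟩ := exists_norm_truncation_eisensteinSeriesU_flatSectionU_le_uniform_cm_three L ν h𝓕 hT hKc hKc2 hφc hφM hφB hM₁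
  exact ⟨max M₀ M₁, h⟩

end Summit.HodgeConjecture.HodgeConjecture.Cruxes.H413.K2E1EisensteinMinusConstantTermBoundedCMThreeUniform

end
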